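import Summits.NavierStokesRegularity.NavierStokesRegularity.Theses.PalasekTowerBreakdown
import Summits.NavierStokesRegularity.FluidComputer.PalasekTowerFaceNecessity

/-!
# `EpisodeBase` BY NAME as a lower bound on two universal Navier–Stokes constants (crux idea `universal-face-constants`)

Cell `ns-blowup`, seat `ns-palasek-19179-p2` (g2; holder of record of the crux `EpisodeBase` of the route
`PalasekTowerBreakdown`, item stmt-NavierStokesRegularity-19179, line `slot`). By-name corollaries, for the ROUTE DECLS, of
`FluidComputer/PalasekTowerFaceNecessity.lean` (the necessity lemmas of the crux idea card
`Cruxes/EpisodeBase/Ideas/universal-face-constants.md`, lens `dual`, 19179 evidence #53/#54/#58, PROVED there):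

* METER form (the card's thesis, by name): `EpisodeBase` forces `κ(windowCeil 0, φ) ≥ gradFloorCeil 0 = 0.0578`
  (`palasekTowerBreakdown_gradFloorCeil_le_of_episodeBase`), `𝔄(windowAnch, runAnch, φ) ≥ floorAnch = 2.056`
  (`palasekTowerBreakdown_floorAnch_le_of_episodeBase`) and `𝔄(windowStart 0, runRatio 0, φ) ≥ floorOverStart 0 = 1.234`
  (`palasekTowerBreakdown_floorOverStart_le_of_episodeBase`) for every admissible force budget `φ` — every primal design
  for 19179 must beat these numbers, and every certified constant below them refutes the crux;
* DOOR form: `palasekTowerBreakdown_not_episodeBase_of_gradientProductionBound` / `…_of_speedAmplificationBound` /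
  `…_of_speedAmplificationBound_anchored`, and `EpisodeBase ↔ ¬ NoStageAbove 0`;
* one level up, on the heredity items: `NoStageAbove 1 → HeredityFromTwo` (VACUOUS — sterile closure, flagged) and
  `NoStageAbove 1 → EpisodeBase → ¬ HeredityAtOne`.

LABEL: E–C typing (KERNEL, proofs only, by name). WHAT THIS IS NOT: not Navier–Stokes evidence — conditional implications;
no explicit constant is asserted or in print (critic #58 F1 null; refuter4 K90 (3): the envelope does not expect the doors to
fire); nothing about any flow after `τ₀`, about `RungG 1` or blow-up. HELPER for 19179 (`--supports`), closes nothing.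

References: S. Palasek, arXiv:2605.13827 §3.3–§4 [cite: Palasek2026ElementaryModel, §4]; G. Seregin, *Lecture Notes on
Regularity Theory for the Navier–Stokes Equations* (2014), Prop. 3.9 [cite: Seregin2014, Prop. 3.9].
-/

noncomputable section

-- `Summit.<Summit>.<Problem>` is the tree's mandated summit-side namespace (CONVENTIONS §2); for this
-- single-conjunct summit the two coincide, so the duplicate is deliberate.
set_option linter.dupNamespace false

namespace Summit.NavierStokesRegularity.NavierStokesRegularity.Theorems

open Summit.NavierStokesRegularity.FluidComputer.PalasekTowerClayBridge
open Summit.NavierStokesRegularity.FluidComputer.PalasekTowerClayBridge.UniversalFace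

/-- The route's crux `EpisodeBase` is exactly «level `1` is NOT empty» (`RungG 1 = EpisodeBaseG`). [folklore] -/
theorem palasekTowerBreakdown_episodeBase_iff_not_noStageAbove_zero :
    Summit.NavierStokesRegularity.NavierStokesRegularity.Theses.PalasekTowerBreakdown.EpisodeBase ↔ ¬ NoStageAbove 0 := by
  rw [noStageAbove_zero_iff, not_not]
  rfl

/-- **METER G₀, by name**: if the crux holds, every gradient-production constant valid at the window-`0` parameters
(`s = windowCeil 0 = 3826.5`, forces up to `φ ≥ forceCeil 0`) is at least the registered strain-face ratio
`gradFloorCeil 0 = 0.0578` — the crux is a LOWER BOUND `κ(3826.5, φ) ≥ 0.0578` on the universal constant.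
[cite: Palasek2026ElementaryModel, §3.3] -/
theorem palasekTowerBreakdown_gradFloorCeil_le_of_episodeBase
    (h : Summit.NavierStokesRegularity.NavierStokesRegularity.Theses.PalasekTowerBreakdown.EpisodeBase) {κ φ : ℝ}
    (hφ : forceCeil 0 ≤ φ) (hB : GradientProductionBound (windowCeil 0) φ κ) : gradFloorCeil 0 ≤ κ :=
  le_of_not_gt fun hκ => not_episodeBaseG_of_gradientProductionBound hB hφ hκ h

/-- **METER S₀ᴬ, by name**: if the crux holds, every speed-amplification constant valid at the anchored window-`0`
parameters (`s = windowAnch = 325.8`, running bound `runAnch = 3.427`, forces up to `φ ≥ forceAnch`) is at least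
`floorAnch = Y₁/Y₀ = 2.056` — the crux is a LOWER BOUND `𝔄(325.8, 3.427, φ) ≥ 2.056`. [cite: Palasek2026ElementaryModel, §3.3] -/
theorem palasekTowerBreakdown_floorAnch_le_of_episodeBase
    (h : Summit.NavierStokesRegularity.NavierStokesRegularity.Theses.PalasekTowerBreakdown.EpisodeBase) {a φ : ℝ}
    (hφ : forceAnch ≤ φ) (hB : SpeedAmplificationBound windowAnch runAnch φ a) : floorAnch ≤ a :=
  le_of_not_gt fun ha => not_episodeBaseG_of_speedAmplificationBound_anchored hB hφ ha h

/-- **METER S₀, by name** (start units `m = c₂ Y₀`): if the crux holds, every speed-amplification constant valid at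
`(windowStart 0, runRatio 0) = (905.0, 2.056)` with forces up to `φ ≥ forceStart 0` is at least `floorOverStart 0 = 1.234`.
[cite: Palasek2026ElementaryModel, §3.3] -/
theorem palasekTowerBreakdown_floorOverStart_le_of_episodeBase
    (h : Summit.NavierStokesRegularity.NavierStokesRegularity.Theses.PalasekTowerBreakdown.EpisodeBase) {a φ : ℝ}
    (hφ : forceStart 0 ≤ φ) (hB : SpeedAmplificationBound (windowStart 0) (runRatio 0) φ a) : floorOverStart 0 ≤ a :=
  le_of_not_gt fun ha => not_episodeBaseG_of_speedAmplificationBound hB hφ ha h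

/-- **DOOR G₀, by name**: an explicit gradient-production constant `κ < gradFloorCeil 0` at the window-`0` parameters
refutes the route's crux `EpisodeBase`. [cite: Palasek2026ElementaryModel, §3.3] -/
theorem palasekTowerBreakdown_not_episodeBase_of_gradientProductionBound {κ φ : ℝ}
    (hB : GradientProductionBound (windowCeil 0) φ κ) (hφ : forceCeil 0 ≤ φ) (hκ : κ < gradFloorCeil 0) :
    ¬ Summit.NavierStokesRegularity.NavierStokesRegularity.Theses.PalasekTowerBreakdown.EpisodeBase :=
  not_episodeBaseG_of_gradientProductionBound hB hφ hκ

/-- **DOOR S₀, by name** (start units): an explicit speed-amplification constant `a < floorOverStart 0` at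
`(windowStart 0, runRatio 0)` refutes the route's crux. [cite: Palasek2026ElementaryModel, §3.3] -/
theorem palasekTowerBreakdown_not_episodeBase_of_speedAmplificationBound {a φ : ℝ}
    (hB : SpeedAmplificationBound (windowStart 0) (runRatio 0) φ a) (hφ : forceStart 0 ≤ φ)
    (ha : a < floorOverStart 0) :
    ¬ Summit.NavierStokesRegularity.NavierStokesRegularity.Theses.PalasekTowerBreakdown.EpisodeBase :=
  not_episodeBaseG_of_speedAmplificationBound hB hφ ha

/-- **DOOR S₀ᴬ, by name** (anchored units): an explicit speed-amplification constant `a < floorAnch = 2.056` at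
`(windowAnch, runAnch) = (325.8, 3.427)` refutes the route's crux. [cite: Palasek2026ElementaryModel, §3.3] -/
theorem palasekTowerBreakdown_not_episodeBase_of_speedAmplificationBound_anchored {a φ : ℝ}
    (hB : SpeedAmplificationBound windowAnch runAnch φ a) (hφ : forceAnch ≤ φ) (ha : a < floorAnch) :
    ¬ Summit.NavierStokesRegularity.NavierStokesRegularity.Theses.PalasekTowerBreakdown.EpisodeBase :=
  not_episodeBaseG_of_speedAmplificationBound_anchored hB hφ ha

/-- **One level up, sterile closure (flagged)**: an empty level `2` makes the route's `HeredityFromTwo` hold VACUOUSLY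
(no stage at any level `≥ 2` exists to be extended) — a closure without content, which the planner reads as the
register's death above level `1`, not as heredity. [folklore] -/
theorem palasekTowerBreakdown_heredityFromTwo_of_noStageAbove_one (h : NoStageAbove 1) :
    Summit.NavierStokesRegularity.NavierStokesRegularity.Theses.PalasekTowerBreakdown.HeredityFromTwo :=
  h.heredityFrom

/-- **One level up, the honest bite**: an empty level `2` together with the crux refutes the route's first rung
`HeredityAtOne`. [folklore] -/
theorem palasekTowerBreakdown_not_heredityAtOne_of_noStageAbove_one (h : NoStageAbove 1)
    (hK : Summit.NavierStokesRegularity.NavierStokesRegularity.Theses.PalasekTowerBreakdown.EpisodeBase) :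
    ¬ Summit.NavierStokesRegularity.NavierStokesRegularity.Theses.PalasekTowerBreakdown.HeredityAtOne :=
  h.not_heredityAtOne hK

/-- … so a gradient-production constant below the window-`1` floor ratio `gradFloorCeil 1 = 0.0481` would close
`HeredityFromTwo` vacuously and, given the crux, refute `HeredityAtOne`. [cite: Palasek2026ElementaryModel, §3.3] -/
theorem palasekTowerBreakdown_heredity_of_gradientProductionBound_one {κ φ : ℝ}
    (hB : GradientProductionBound (windowCeil 1) φ κ) (hφ : forceCeil 1 ≤ φ) (hκ : κ < gradFloorCeil 1) :
    Summit.NavierStokesRegularity.NavierStokesRegularity.Theses.PalasekTowerBreakdown.HeredityFromTwo ∧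
      (Summit.NavierStokesRegularity.NavierStokesRegularity.Theses.PalasekTowerBreakdown.EpisodeBase →
        ¬ Summit.NavierStokesRegularity.NavierStokesRegularity.Theses.PalasekTowerBreakdown.HeredityAtOne) :=
  heredityFrom_two_and_of_gradientProductionBound_one hB hφ hκ

end Summit.NavierStokesRegularity.NavierStokesRegularity.Theorems

end
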